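import Literature.NumberTheory.LFunctions.YoshidaWindowSpaces
import Literature.NumberTheory.LFunctions.WeilFirstPrimePositivityTwoFifths
import Literature.NumberTheory.LFunctions.WeilExplicitApproxIdentity
import Literature.NumberTheory.LFunctions.WeilSquareMollifier
import Literature.NumberTheory.LFunctions.WeilFiniteCodimension
import Literature.NumberTheory.LFunctions.WeilWindowSimpleEven
import Literature.NumberTheory.LFunctions.WeilGroundStateRealZerosProofs
import HarnessLib

/-!
# Yoshida's Theorem 1 on the window space `K(log 2/2)`: the discharge of `Yoshida1992.theorem1`

Sibling proof file of `Literature/NumberTheory/LFunctions/YoshidaWindowSpaces.lean`, which vendors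

> **Theorem 1** (H. Yoshida, *On Hermitian forms attached to zeta functions*, Adv. Stud. Pure
> Math. **21** (1992), p. 310). Let `a = log 2/2`. We have `(φ, φ) ≥ 0` for every `φ ∈ K(a)`,
> where equality holds if and only if `φ = 0`.

as the named fact `Yoshida1992.theorem1 : ∀ φ ∈ K (log 2 / 2), 0 ≤ Re Q φ ∧ (Q φ = 0 ↔ φ = 0)`
(`Q = weilQuadratic`, `K(a)` = restrictions to `[−a, a]` of smooth `2a`-periodic functions,
extended by zero — functions with JUMPS at `±a`). Here `theorem1_holds : theorem1` is PROVED.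

## The printed proof and the proof given here

Yoshida (§6, pp. 302–310) proves Theorem 1 by a computer-assisted certificate on `K(a)` itself:
the coercive estimates (6.8)/(6.9) on `K_N(a)` (`N = 10`, resp. `199`) from his Lemma 3, and the
positive definiteness of a `10 × 10` (odd sector) and a `200 × 200` (even sector) hermitian matrix.
The tree already holds kernel-checked certificates of the SAME kind for smooth test functions on
LARGER windows — `weilPositivityOn_two_fifths : WeilPositivityOn (2/5)`
(`WeilFirstPrimePositivityTwoFifths.lean`; `2/5 > log 2/2 = 0.3465…`) — and Yoshida's own route to
non-degeneracy, **Proposition 2** (p. 291). We therefore argue as follows (no new certificate).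

* **(A) `(φ, φ) ≥ 0` on `K(a)`** (§6 of this file). Mollify: `φ_m = φ ⋆ ρ_m` with the tree's normalised
  bumps `ρ_m = WeilContinuous.moll m` of radius `1/(m+1)`. Then `φ_m` is a test function supported in
  `[−(a + 1/(m+1)), a + 1/(m+1)] ⊆ [−2/5, 2/5]`, so `Re Q(φ_m) ≥ 0` by the `2/5` rung; and
  `Q(φ_m) = W(F ⋆ ν_m)` with `F = φ ⋆ φ̃` and the square mollifiers `ν_m = ρ_m ⋆ ρ̃_m`
  (`WeilSquareMollifier.lean`), whence `Q(φ_m) → W(F) = Q(φ)` by the tree's approximate-identity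
  theorem `WeilApproxIdentity.tendsto_weilFunctional` (Bombieri 2000 §3). Its hypotheses on `F` —
  continuity, compact support, integrability of the archimedean integrand
  `F̂(½+it) Re ψ(¼+it/2)` — are checked in §4–§5: `F̂(½+it) = |φ̂(½+it)|²` (Fubini) and
  `|φ̂(½+it)|² (1+t²) ≤ D` by ONE partial integration on `[−a, a]` (Yoshida p. 289, "by partial
  integration"; here the boundary terms do not cancel and are kept), against `|ψ| ≤ C + log(1+|t|)`.
* **(B) `(φ, φ) = 0 ⇒ φ = 0`** (§7–§9). If `Re Q(φ) = 0` then, expanding `Re Q(φ_m + λψ) ≥ 0`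
  (`weilQuadratic_add`, rung `2/5`) and letting `m → ∞`, `W(φ ⋆ ψ̃) = 0` for every test `ψ`
  supported in `[−2/5, 2/5]` (Cauchy–Schwarz). Consequently the SMOOTH function `g = φ ⋆ ρ_m`
  (`m ≥ 39`) lies in the radical `V₀ = {g ∈ C(c) : (g, ψ) = 0 ∀ ψ ∈ C(c)}` of the form on
  `C(c)`, `c = a + 1/(m+1)`. **Proposition 2** (p. 291: "the restriction of the hermitian form to
  `C(a)` is non-degenerate", proof: `V₀ ∩ C_N(a) = {0}` by Lemma 3, so `dim V₀ ≤ 2N + 1`; `V₀` is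
  stable under `d/dx`; a non-zero solution of a constant-coefficient ODE is not compactly supported)
  is proved in §8 with the tree's fine-grid Lemma 3 (`weilQuadratic_re_ge_of_grid_zero`,
  `WeilFiniteCodimension.lean`) and an eigenvector of `d/dx` on the finite-dimensional `V₀`
  (`g′ = λ g` forces `g = C e^{λx}`, so `g = 0`). Hence `φ ⋆ ρ_m = 0` for all `m ≥ 39`, and
  `φ = lim_m (φ ⋆ ρ_m)(x) = 0` at every continuity point `x ≠ ±a` of `φ`, so `φ = 0`.

Everything here is proved; there are no definitions and no named facts. The convolution algebra of
§2 (commutativity, associativity, behaviour under `̃`) is stated for integrable bounded functions,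
since the elements of `K(a)` are not continuous.

## References

* H. Yoshida, *On Hermitian forms attached to zeta functions*, Adv. Stud. Pure Math. 21 (1992)
  281–325 [Yoshida1992HermitianForms]: Theorem 1 (p. 310), §6 (6.1) (p. 302), Lemma 3 (p. 290),
  Proposition 2 (p. 291), (3.1) (p. 289).
* E. Bombieri, *Remarks on Weil's quadratic functional in the theory of prime numbers I*, Rend.
  Mat. Acc. Lincei (9) 11 (2000) [Bombieri2000Weil], §3 (mollification of the functional).
-/

noncomputable section

open Complex Set MeasureTheory Filter Topology
open scoped Real ComplexConjugate ContDiff Convolution Interval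

namespace Literature.NumberTheory.LFunctions

namespace Yoshida1992

open _root_.MeasureTheory _root_.Topology WeilContinuous

/-! ## §1 Elements of `K(a)`: measurability, boundedness, integrability, support -/

section KBasics

variable {a : ℝ} {φ : ℝ → ℂ}

/-- An element of `K(a)` is the indicator of `[−a, a]` times its smooth periodic representative.
[cite: Yoshida1992HermitianForms, §2 p. 287 (definition of K(a))] -/
theorem eq_indicator_of_mem_K (h : φ ∈ K a) :
    ∃ f : ℝ → ℂ, ContDiff ℝ ∞ f ∧ φ = (Icc (-a) a).indicator f := by
  obtain ⟨f, hf, -, hφf, hφ0⟩ := h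
  refine ⟨f, hf, funext fun x ↦ ?_⟩
  by_cases hx : |x| ≤ a
  · rw [hφf x hx, indicator_of_mem (by simpa [abs_le] using hx)]
  · rw [hφ0 x (not_le.1 hx), indicator_of_notMem]
    intro hmem
    exact hx (abs_le.2 ⟨hmem.1, hmem.2⟩)

/-- Elements of `K(a)` are a.e. strongly measurable. [cite: Yoshida1992HermitianForms, §2 p. 287 (definition of K(a))] -/
theorem aestronglyMeasurable_of_mem_K (h : φ ∈ K a) : AEStronglyMeasurable φ volume := by
  obtain ⟨f, hf, rfl⟩ := eq_indicator_of_mem_K h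
  exact hf.continuous.aestronglyMeasurable.indicator measurableSet_Icc

/-- Elements of `K(a)` are bounded. [cite: Yoshida1992HermitianForms, §2 p. 287 (definition of K(a))] -/
theorem exists_bound_of_mem_K (h : φ ∈ K a) : ∃ C : ℝ, 0 ≤ C ∧ ∀ x, ‖φ x‖ ≤ C := by
  obtain ⟨f, hf, rfl⟩ := eq_indicator_of_mem_K h
  obtain ⟨C, hC⟩ := (isCompact_Icc (a := -a) (b := a)).exists_bound_of_continuousOn
    hf.continuous.continuousOn
  refine ⟨max C 0, le_max_right _ _, fun x ↦ ?_⟩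
  by_cases hx : x ∈ Icc (-a) a
  · rw [indicator_of_mem hx]; exact (hC x hx).trans (le_max_left _ _)
  · rw [indicator_of_notMem hx, norm_zero]; exact le_max_right _ _

/-- Elements of `K(a)` are integrable. [cite: Yoshida1992HermitianForms, §2 p. 287 (definition of K(a))] -/
theorem integrable_of_mem_K (h : φ ∈ K a) : Integrable φ := by
  obtain ⟨f, hf, rfl⟩ := eq_indicator_of_mem_K h
  exact (integrable_indicator_iff measurableSet_Icc).2 hf.continuous.integrableOn_Icc

/-- Elements of `K(a)` are locally integrable. [cite: Yoshida1992HermitianForms, §2 p. 287 (definition of K(a))] -/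
theorem locallyIntegrable_of_mem_K (h : φ ∈ K a) : LocallyIntegrable φ volume :=
  (integrable_of_mem_K h).locallyIntegrable

/-- The support of an element of `K(a)` lies in `[−a, a]`. [cite: Yoshida1992HermitianForms, §2 p. 287 (definition of K(a))] -/
theorem support_subset_of_mem_K (h : φ ∈ K a) : Function.support φ ⊆ Icc (-a) a := by
  intro x hx
  by_contra hxa
  have : a < |x| := by
    rw [mem_Icc, ← abs_le, not_le] at hxa; exact hxa
  exact hx (eq_zero_of_mem_K h this)

/-- The topological support of an element of `K(a)` lies in `[−a, a]`. [cite: Yoshida1992HermitianForms, §2 p. 287 (definition of K(a))] -/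
theorem tsupport_subset_of_mem_K (h : φ ∈ K a) : tsupport φ ⊆ Icc (-a) a :=
  closure_minimal (support_subset_of_mem_K h) isClosed_Icc

/-- Elements of `K(a)` have compact support. [cite: Yoshida1992HermitianForms, §2 p. 287 (definition of K(a))] -/
theorem hasCompactSupport_of_mem_K (h : φ ∈ K a) : HasCompactSupport φ :=
  HasCompactSupport.of_support_subset_isCompact isCompact_Icc (support_subset_of_mem_K h)

/-- `K(a)` is stable under the involution `φ̃(x) = conj φ(−x)`. [cite: Yoshida1992HermitianForms, §2 p. 287 (the form (φ₁, φ₂) = T(φ₁ * φ̃₂))] -/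
theorem weilReflect_mem_K (h : φ ∈ K a) : weilReflect φ ∈ K a := by
  obtain ⟨f, hf, hper, hφf, hφ0⟩ := h
  refine ⟨fun x ↦ conj (f (-x)), ?_, ?_, fun x hx ↦ ?_, fun x hx ↦ ?_⟩
  · exact ContDiff.comp Complex.conjCLE.contDiff (hf.comp contDiff_neg)
  · intro x
    simp only
    have := hper (-x - 2 * a)
    rw [show -x - 2 * a + 2 * a = -x by ring] at this
    rw [show -(x + 2 * a) = -x - 2 * a by ring, this]
  · simp only [weilReflect]
    rw [hφf (-x) (by rwa [abs_neg])]
  · simp only [weilReflect]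
    rw [hφ0 (-x) (by rwa [abs_neg]), map_zero]

/-- An element of `K(a)` is continuous at every point `x` with `|x| ≠ a` (it agrees near `x` with
its smooth representative, resp. with `0`). [cite: Yoshida1992HermitianForms, §2 p. 287 (definition of K(a))] -/
theorem continuousAt_of_mem_K (h : φ ∈ K a) {x : ℝ} (hx : |x| ≠ a) : ContinuousAt φ x := by
  obtain ⟨f, hf, rfl⟩ := eq_indicator_of_mem_K h
  rcases lt_or_gt_of_ne hx with hlt | hgt
  · -- interior point: `φ = f` near `x`
    have hnhds : Ioo (-a) a ∈ 𝓝 x := Ioo_mem_nhds (by rw [abs_lt] at hlt; exact hlt.1)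
      (by rw [abs_lt] at hlt; exact hlt.2)
    refine (hf.continuous.continuousAt).congr_of_eventuallyEq ?_
    filter_upwards [hnhds] with y hy
    rw [indicator_of_mem (Ioo_subset_Icc_self hy)]
  · -- exterior point: `φ = 0` near `x`
    have hnhds : (Icc (-a) a)ᶜ ∈ 𝓝 x := by
      refine isOpen_compl_iff.2 isClosed_Icc |>.mem_nhds ?_
      intro hmem
      have : |x| ≤ a := abs_le.2 ⟨hmem.1, hmem.2⟩
      exact (not_lt.2 this) hgt
    refine (continuousAt_const (y := (0 : ℂ))).congr_of_eventuallyEq ?_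
    filter_upwards [hnhds] with y hy
    rw [indicator_of_notMem hy]

end KBasics

/-! ## §2 Convolution algebra for integrable bounded functions

The elements of `K(a)` are not continuous, so the test-function lemmas of the tree
(`weilConv_add_left`, …) do not apply to them; the identities below need only integrability and
boundedness (associativity: Mathlib's `MeasureTheory.convolution_assoc`, Fubini). -/

section ConvAlgebra

/-- Commutativity of `weilConv` (Mathlib `convolution_flip`; `ℝ` is abelian and
`ContinuousLinearMap.mul ℂ ℂ` is its own flip); no hypotheses. [folklore] -/
private theorem weilConv_comm (f g : ℝ → ℂ) : weilConv f g = weilConv g f := by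
  have h := convolution_flip (L := ContinuousLinearMap.mul ℂ ℂ) (μ := (volume : Measure ℝ))
    (f := f) (g := g)
  rw [ContinuousLinearMap.flip_mul] at h
  exact h.symm

/-- The involution is involutive: `(g̃)̃ = g`. [folklore] -/
private theorem weilReflect_weilReflect (g : ℝ → ℂ) : weilReflect (weilReflect g) = g := by
  funext t
  simp [weilReflect]

/-- The involution of a convolution: `(f ⋆ g)̃ = f̃ ⋆ g̃` (substitute `u ↦ −u`); no hypotheses.
[folklore] -/
private theorem weilReflect_weilConv (f g : ℝ → ℂ) :
    weilReflect (weilConv f g) = weilConv (weilReflect f) (weilReflect g) := by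
  funext t
  simp only [weilReflect]
  rw [weilConv_apply, weilConv_apply, ← integral_conj,
    ← integral_neg_eq_self (fun u : ℝ ↦ conj (f u * g (-t - u))) volume]
  refine integral_congr_ae (Eventually.of_forall fun u ↦ ?_)
  simp only [map_mul]
  congr 2
  ring

/-- The convolution integrand `u ↦ f(u) g(x − u)` is integrable when `f` is integrable and `g` is
bounded and a.e. strongly measurable. [folklore] -/
private theorem convolutionExistsAt_of_integrable_of_bdd {f g : ℝ → ℂ} (hf : Integrable f)
    (hg : AEStronglyMeasurable g volume) (hgb : ∃ C, ∀ x, ‖g x‖ ≤ C) (x : ℝ) :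
    ConvolutionExistsAt f g x (ContinuousLinearMap.mul ℂ ℂ) volume := by
  obtain ⟨C, hC⟩ := hgb
  unfold ConvolutionExistsAt
  have hmeas : AEStronglyMeasurable (fun t : ℝ ↦ g (x - t)) volume :=
    hg.comp_quasiMeasurePreserving (quasiMeasurePreserving_sub_left_of_right_invariant volume x)
  have h := hf.mul_bdd hmeas (Eventually.of_forall fun t ↦ hC (x - t))
  simpa [ContinuousLinearMap.mul_apply'] using h

/-- Real version of the previous lemma (for the norms). [folklore] -/
private theorem convolutionExistsAt_real_of_integrable_of_bdd {f g : ℝ → ℝ} (hf : Integrable f)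
    (hg : AEStronglyMeasurable g volume) (hgb : ∃ C, ∀ x, ‖g x‖ ≤ C) (x : ℝ) :
    ConvolutionExistsAt f g x (ContinuousLinearMap.mul ℝ ℝ) volume := by
  obtain ⟨C, hC⟩ := hgb
  unfold ConvolutionExistsAt
  have hmeas : AEStronglyMeasurable (fun t : ℝ ↦ g (x - t)) volume :=
    hg.comp_quasiMeasurePreserving (quasiMeasurePreserving_sub_left_of_right_invariant volume x)
  have h := hf.mul_bdd hmeas (Eventually.of_forall fun t ↦ hC (x - t))
  simpa [ContinuousLinearMap.mul_apply'] using h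

/-- A convolution `‖g‖ ⋆ ‖k‖` with `g` bounded and `k` integrable is bounded by `sup ‖g‖ · ∫ ‖k‖`.
[folklore] -/
private theorem norm_convolution_norm_le {g k : ℝ → ℂ} {C : ℝ} (hC : ∀ x, ‖g x‖ ≤ C)
    (hk : Integrable k) (x : ℝ) :
    ‖((fun x ↦ ‖g x‖) ⋆[ContinuousLinearMap.mul ℝ ℝ, volume] fun x ↦ ‖k x‖) x‖ ≤
      C * ∫ t, ‖k t‖ := by
  rw [convolution_def]
  have hC0 : 0 ≤ C := (norm_nonneg _).trans (hC 0)
  have hpt : ∀ t : ℝ, ‖(ContinuousLinearMap.mul ℝ ℝ) ‖g t‖ ‖k (x - t)‖‖ ≤ C * ‖k (x - t)‖ := by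
    intro t
    rw [ContinuousLinearMap.mul_apply', Real.norm_of_nonneg (by positivity)]
    exact mul_le_mul_of_nonneg_right (hC t) (norm_nonneg _)
  calc ‖∫ t, (ContinuousLinearMap.mul ℝ ℝ) ‖g t‖ ‖k (x - t)‖‖
      ≤ ∫ t, ‖(ContinuousLinearMap.mul ℝ ℝ) ‖g t‖ ‖k (x - t)‖‖ := norm_integral_le_integral_norm _
    _ ≤ ∫ t, C * ‖k (x - t)‖ := by
        refine integral_mono_of_nonneg (Eventually.of_forall fun _ ↦ norm_nonneg _)
          ((hk.norm.comp_sub_left x).const_mul C) (Eventually.of_forall hpt)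
    _ = C * ∫ t, ‖k t‖ := by
        rw [integral_const_mul, integral_sub_left_eq_self (fun t ↦ ‖k t‖) volume x]

/-- **Associativity of `weilConv`** for integrable functions, the last two bounded
(`MeasureTheory.convolution_assoc`). [folklore] -/
private theorem weilConv_assoc {f g k : ℝ → ℂ} (hf : Integrable f) (hg : Integrable g) (hk : Integrable k)
    (hgb : ∃ C, ∀ x, ‖g x‖ ≤ C) (hkb : ∃ C, ∀ x, ‖k x‖ ≤ C) :
    weilConv (weilConv f g) k = weilConv f (weilConv g k) := by
  funext x₀
  simp only [weilConv]
  obtain ⟨Cg, hCg⟩ := hgb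
  obtain ⟨Ck, hCk⟩ := hkb
  refine convolution_assoc (ContinuousLinearMap.mul ℂ ℂ) (ContinuousLinearMap.mul ℂ ℂ)
    (ContinuousLinearMap.mul ℂ ℂ) (ContinuousLinearMap.mul ℂ ℂ) (fun x y z ↦ mul_assoc x y z)
    hf.aestronglyMeasurable hg.aestronglyMeasurable hk.aestronglyMeasurable
    (Eventually.of_forall fun y ↦
      convolutionExistsAt_of_integrable_of_bdd hf hg.aestronglyMeasurable ⟨Cg, hCg⟩ y)
    (Eventually.of_forall fun y ↦
      convolutionExistsAt_real_of_integrable_of_bdd hg.norm hk.aestronglyMeasurable.norm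
        ⟨Ck, fun x ↦ by simpa using hCk x⟩ y) ?_
  -- `‖f‖ ⋆ (‖g‖ ⋆ ‖k‖)` exists at `x₀`: `‖g‖ ⋆ ‖k‖` is bounded and measurable
  refine convolutionExistsAt_real_of_integrable_of_bdd hf.norm ?_
    ⟨Cg * ∫ t, ‖k t‖, fun x ↦ norm_convolution_norm_le hCg hk x⟩ x₀
  exact (hg.norm.integrable_convolution (ContinuousLinearMap.mul ℝ ℝ) hk.norm).aestronglyMeasurable

/-- A continuous compactly supported function is integrable and bounded (the form in which test
functions and mollifiers enter `weilConv_assoc`). [folklore] -/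
private theorem integrable_and_bdd_of_continuous {g : ℝ → ℂ} (hg : Continuous g) (hgs : HasCompactSupport g) :
    Integrable g ∧ ∃ C, ∀ x, ‖g x‖ ≤ C :=
  ⟨hg.integrable_of_hasCompactSupport hgs, hg.bounded_above_of_compact_support hgs⟩

end ConvAlgebra

/-! ## §3 The convolution theorem on the critical line for integrable factors -/

section ConvTheorem

/-- `(f ⋆ g)^(s) = f̂(s) ĝ(s)` as soon as `f e^{(s−½)·}` and `g e^{(s−½)·}` are integrable
(Fubini, `MeasureTheory.integral_convolution`; the tree's `weilMellin_weilConv_holds` is the case of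
continuous compactly supported factors). [cite: Bombieri2000Weil, §3] -/
theorem weilMellin_weilConv_of_integrable {f g : ℝ → ℂ} {s : ℂ}
    (hf : Integrable fun u : ℝ ↦ f u * cexp ((s - 1 / 2) * u))
    (hg : Integrable fun u : ℝ ↦ g u * cexp ((s - 1 / 2) * u)) :
    weilMellin (weilConv f g) s = weilMellin f s * weilMellin g s := by
  set c : ℂ := s - 1 / 2 with hc
  set G : ℝ → ℂ := fun u ↦ f u * cexp (c * u) with hG
  set H : ℝ → ℂ := fun u ↦ g u * cexp (c * u) with hH
  have key : ∀ t : ℝ, weilConv f g t * cexp (c * t) = (G ⋆[ContinuousLinearMap.mul ℂ ℂ] H) t := by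
    intro t
    rw [weilConv_apply, convolution_def, ← integral_mul_const]
    congr 1 with u
    simp only [hG, hH, ContinuousLinearMap.mul_apply']
    have he : cexp (c * t) = cexp (c * u) * cexp (c * ((t - u : ℝ) : ℂ)) := by
      rw [← Complex.exp_add]
      push_cast
      ring_nf
    rw [he]
    ring
  have hL : weilMellin (weilConv f g) s = ∫ t : ℝ, (G ⋆[ContinuousLinearMap.mul ℂ ℂ] H) t := by
    unfold weilMellin
    exact integral_congr_ae (Eventually.of_forall fun t ↦ key t)
  rw [hL, integral_convolution (ContinuousLinearMap.mul ℂ ℂ) hf hg, ContinuousLinearMap.mul_apply']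
  rfl

/-- On the critical line the weight `e^{itx}` is unimodular, so plain integrability suffices:
`(f ⋆ g)^(½+it) = f̂(½+it) ĝ(½+it)` for integrable `f, g`. [cite: Bombieri2000Weil, §3] -/
theorem weilMellin_weilConv_half_line {f g : ℝ → ℂ} (hf : Integrable f) (hg : Integrable g) (t : ℝ) :
    weilMellin (weilConv f g) (1 / 2 + t * I) =
      weilMellin f (1 / 2 + t * I) * weilMellin g (1 / 2 + t * I) := by
  have hw : ∀ u : ℝ, ‖cexp ((1 / 2 + (t : ℂ) * I - 1 / 2) * u)‖ ≤ 1 := fun u ↦ by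
    have e : (1 / 2 + (t : ℂ) * I - 1 / 2) * (u : ℂ) = ((t * u : ℝ) : ℂ) * I := by push_cast; ring
    rw [e, Complex.norm_exp_ofReal_mul_I]
  have hmeas : AEStronglyMeasurable (fun u : ℝ ↦ cexp ((1 / 2 + (t : ℂ) * I - 1 / 2) * u)) volume :=
    (by fun_prop : Continuous fun u : ℝ ↦ cexp ((1 / 2 + (t : ℂ) * I - 1 / 2) * u)).aestronglyMeasurable
  exact weilMellin_weilConv_of_integrable (hf.mul_bdd hmeas (Eventually.of_forall hw))
    (hg.mul_bdd hmeas (Eventually.of_forall hw))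

/-- On the critical line `(φ ⋆ φ̃)^(½+it) = |φ̂(½+it)|²` for every integrable `φ`
(the tree's `weilMellin_weilConv_weilReflect_half` for test functions). [cite: Yoshida1992HermitianForms, §2 p. 288 (F̂(t) = |φ̂(t)|²)] -/
theorem weilMellin_weilConv_weilReflect_half_of_integrable {φ : ℝ → ℂ} (hφ : Integrable φ) (t : ℝ) :
    weilMellin (weilConv φ (weilReflect φ)) (1 / 2 + t * I) =
      ((‖weilMellin φ (1 / 2 + t * I)‖ ^ 2 : ℝ) : ℂ) := by
  have hφ' : Integrable (weilReflect φ) := by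
    unfold weilReflect
    exact (Complex.conjLIE.toContinuousLinearMap.integrable_comp (hφ.comp_neg)).congr
      (Eventually.of_forall fun t ↦ by simp)
  rw [weilMellin_weilConv_half_line hφ hφ' t, weilMellin_weilReflect_holds]
  have h1 : (1 : ℂ) - conj (1 / 2 + (t : ℂ) * I) = 1 / 2 + (t : ℂ) * I := by
    apply Complex.ext <;> norm_num
  rw [h1, Complex.mul_conj, Complex.normSq_eq_norm_sq]

end ConvTheorem

/-! ## §4 Fourier decay on `K(a)`: `|φ̂(½+it)|² (1+t²) ≤ D` (one partial integration) -/

section FourierDecay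

variable {a : ℝ} {φ : ℝ → ℂ}

/-- For `φ = 1_{[−a,a]} f`: `φ̂(½+it) = ∫_{−a}^{a} f(x) e^{itx} dx`. [cite: Yoshida1992HermitianForms, §3 p. 289 (transform of a window function)] -/
theorem weilMellin_half_line_eq_intervalIntegral (ha : 0 < a) {f : ℝ → ℂ}
    (hφ : φ = (Icc (-a) a).indicator f) (t : ℝ) :
    weilMellin φ (1 / 2 + t * I) = ∫ x in (-a)..a, f x * cexp (t * I * x) := by
  rw [weilMellin_half_line_eq, hφ]
  have h : (fun x : ℝ ↦ (Icc (-a) a).indicator f x * cexp (t * I * x)) =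
      (Icc (-a) a).indicator (fun x ↦ f x * cexp (t * I * x)) := by
    funext x
    by_cases hx : x ∈ Icc (-a) a
    · simp [hx]
    · simp [hx]
  rw [h, integral_indicator measurableSet_Icc, intervalIntegral.integral_of_le (by linarith),
    integral_Icc_eq_integral_Ioc]

/-- **Fourier decay on `K(a)`** (Yoshida p. 289 "by partial integration", here for an arbitrary
real frequency, so the boundary terms `f(±a) e^{±ita}/(it)` are kept): for `φ ∈ K(a)`, `a > 0`,
there is `D` with `|φ̂(½+it)|² (1 + t²) ≤ D` for all real `t`
(`|φ̂| ≤ 2a sup|f|` and `|t| |φ̂| ≤ 2 sup|f| + 2a sup|f′|`).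
[cite: Yoshida1992HermitianForms, §3 p. 289–290, (3.1)] -/
theorem exists_norm_sq_weilMellin_mul_le (ha : 0 < a) (h : φ ∈ K a) :
    ∃ D : ℝ, 0 ≤ D ∧ ∀ t : ℝ, ‖weilMellin φ (1 / 2 + t * I)‖ ^ 2 * (1 + t ^ 2) ≤ D := by
  obtain ⟨f, hf, hφ⟩ := eq_indicator_of_mem_K h
  -- bounds for `f` and `f'` on the window
  obtain ⟨S₀, hS₀⟩ := (isCompact_Icc (a := -a) (b := a)).exists_bound_of_continuousOn
    hf.continuous.continuousOn
  have hf'c : Continuous (deriv f) := hf.continuous_deriv (by simp)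
  obtain ⟨S₁, hS₁⟩ := (isCompact_Icc (a := -a) (b := a)).exists_bound_of_continuousOn
    hf'c.continuousOn
  have h0mem : (0 : ℝ) ∈ Icc (-a) a := ⟨by linarith, ha.le⟩
  have hamem : a ∈ Icc (-a) a := ⟨by linarith, le_rfl⟩
  have hnamem : -a ∈ Icc (-a) a := ⟨le_rfl, by linarith⟩
  have hS₀0 : 0 ≤ S₀ := (norm_nonneg _).trans (hS₀ 0 h0mem)
  have hS₁0 : 0 ≤ S₁ := (norm_nonneg _).trans (hS₁ 0 h0mem)
  set C₀ : ℝ := S₀ * (2 * a) with hC₀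
  set C₁ : ℝ := S₀ + S₀ + S₁ * (2 * a) with hC₁
  refine ⟨C₀ ^ 2 + C₁ ^ 2, by positivity, fun t ↦ ?_⟩
  have huIoc : ∀ x ∈ Ι (-a) a, x ∈ Icc (-a) a := fun x hx ↦ by
    rw [uIoc_of_le (by linarith)] at hx; exact ⟨hx.1.le, hx.2⟩
  -- the exponent as `c * x`, `c = it`
  set c : ℂ := t * I with hc
  have hexp : ∀ x : ℝ, ‖cexp (c * x)‖ = 1 := fun x ↦ by
    rw [hc, show (t : ℂ) * I * x = ((t * x : ℝ) : ℂ) * I by push_cast; ring,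
      Complex.norm_exp_ofReal_mul_I]
  have hcn : ‖c‖ = |t| := by
    rw [hc, norm_mul, Complex.norm_I, mul_one, Complex.norm_real, Real.norm_eq_abs]
  have hrepr : weilMellin φ (1 / 2 + t * I) = ∫ x in (-a)..a, f x * cexp (c * x) :=
    weilMellin_half_line_eq_intervalIntegral ha hφ t
  -- bound 0: `‖φ̂‖ ≤ C₀`
  have hb0 : ‖weilMellin φ (1 / 2 + t * I)‖ ≤ C₀ := by
    rw [hrepr]
    have h := intervalIntegral.norm_integral_le_of_norm_le_const (a := -a) (b := a) (C := S₀)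
      (f := fun x ↦ f x * cexp (c * x)) fun x hx ↦ by
        rw [norm_mul, hexp, mul_one]; exact hS₀ x (huIoc x hx)
    rw [show a - -a = 2 * a by ring, abs_of_pos (by positivity : (0 : ℝ) < 2 * a)] at h
    exact h
  -- bound 1: `|t| ‖φ̂‖ ≤ C₁` (one partial integration)
  have hb1 : |t| * ‖weilMellin φ (1 / 2 + t * I)‖ ≤ C₁ := by
    rcases eq_or_ne t 0 with ht | ht
    · rw [ht, abs_zero, zero_mul]; positivity
    have hcne : c ≠ 0 := by
      rw [hc]; exact mul_ne_zero (by exact_mod_cast ht) I_ne_zero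
    have htpos : 0 < |t| := abs_pos.2 ht
    -- the primitive `v = c⁻¹ e^{cx}` of `e^{cx}` and the derivative of `f`
    have hv : ∀ x : ℝ, HasDerivAt (fun y : ℝ ↦ c⁻¹ * cexp (c * y)) (cexp (c * x)) x := by
      intro x
      have h1 : HasDerivAt (fun y : ℝ ↦ c * (y : ℂ)) (c * 1) x :=
        (hasDerivAt_id x).ofReal_comp.const_mul c
      have h2 := (h1.cexp).const_mul c⁻¹
      refine h2.congr_deriv ?_
      rw [mul_one, mul_comm (cexp _) c, ← mul_assoc, inv_mul_cancel₀ hcne, one_mul]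
    have hfd : ∀ x : ℝ, HasDerivAt f (deriv f x) x := fun x ↦
      ((hf.differentiable (by simp)).differentiableAt).hasDerivAt
    have hvc : Continuous fun y : ℝ ↦ cexp (c * y) := by fun_prop
    have hparts := intervalIntegral.integral_mul_deriv_eq_deriv_mul (a := -a) (b := a)
      (u := f) (u' := deriv f) (v := fun y : ℝ ↦ c⁻¹ * cexp (c * y)) (v' := fun y : ℝ ↦ cexp (c * y))
      (fun x _ ↦ hfd x) (fun x _ ↦ hv x) (hf'c.intervalIntegrable _ _) (hvc.intervalIntegrable _ _)
    rw [hrepr, hparts]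
    -- the three terms
    have hT1 : ‖f a * (c⁻¹ * cexp (c * (a : ℝ)))‖ ≤ S₀ * |t|⁻¹ := by
      rw [norm_mul, norm_mul, norm_inv, hcn, hexp, mul_one]
      exact mul_le_mul_of_nonneg_right (hS₀ a hamem) (by positivity)
    have hT2 : ‖f (-a) * (c⁻¹ * cexp (c * ((-a : ℝ) : ℂ)))‖ ≤ S₀ * |t|⁻¹ := by
      rw [norm_mul, norm_mul, norm_inv, hcn, hexp, mul_one]
      exact mul_le_mul_of_nonneg_right (hS₀ (-a) hnamem) (by positivity)
    have hT3 : ‖∫ x in (-a)..a, deriv f x * (c⁻¹ * cexp (c * x))‖ ≤ S₁ * |t|⁻¹ * (2 * a) := by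
      have h := intervalIntegral.norm_integral_le_of_norm_le_const (a := -a) (b := a)
        (C := S₁ * |t|⁻¹) (f := fun x ↦ deriv f x * (c⁻¹ * cexp (c * x))) fun x hx ↦ by
          rw [norm_mul, norm_mul, norm_inv, hcn, hexp, mul_one]
          exact mul_le_mul_of_nonneg_right (hS₁ x (huIoc x hx)) (by positivity)
      rw [show a - -a = 2 * a by ring, abs_of_pos (by positivity : (0 : ℝ) < 2 * a)] at h
      exact h
    have hsum : ‖f a * (c⁻¹ * cexp (c * (a : ℝ))) - f (-a) * (c⁻¹ * cexp (c * ((-a : ℝ) : ℂ))) -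
        ∫ x in (-a)..a, deriv f x * (c⁻¹ * cexp (c * x))‖ ≤
        S₀ * |t|⁻¹ + S₀ * |t|⁻¹ + S₁ * |t|⁻¹ * (2 * a) :=
      (norm_sub_le _ _).trans (add_le_add ((norm_sub_le _ _).trans (add_le_add hT1 hT2)) hT3)
    calc |t| * ‖f a * (c⁻¹ * cexp (c * (a : ℝ))) - f (-a) * (c⁻¹ * cexp (c * ((-a : ℝ) : ℂ))) -
          ∫ x in (-a)..a, deriv f x * (c⁻¹ * cexp (c * x))‖
        ≤ |t| * (S₀ * |t|⁻¹ + S₀ * |t|⁻¹ + S₁ * |t|⁻¹ * (2 * a)) :=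
          mul_le_mul_of_nonneg_left hsum htpos.le
      _ = C₁ := by rw [hC₁]; field_simp
  -- combine: `(1 + t²)‖φ̂‖² = ‖φ̂‖² + (|t| ‖φ̂‖)² ≤ C₀² + C₁²`
  have hn : 0 ≤ ‖weilMellin φ (1 / 2 + t * I)‖ := norm_nonneg _
  have h0' : ‖weilMellin φ (1 / 2 + t * I)‖ ^ 2 ≤ C₀ ^ 2 := pow_le_pow_left₀ hn hb0 2
  have h1' : t ^ 2 * ‖weilMellin φ (1 / 2 + t * I)‖ ^ 2 ≤ C₁ ^ 2 := by
    have := pow_le_pow_left₀ (by positivity) hb1 2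
    rw [mul_pow, sq_abs] at this
    exact this
  nlinarith

end FourierDecay

/-! ## §5 The kernel `F = φ ⋆ φ̃` of an element of `K(a)` -/

section SquareKernel

variable {a : ℝ} {φ : ℝ → ℂ}

/-- `(φ ⋆ φ̃)(x) = ∫ φ(u) conj φ(u − x) du`. [cite: Yoshida1992HermitianForms, §2 p. 287 (F = φ * φ̃)] -/
theorem weilConv_weilReflect_eq (φ : ℝ → ℂ) :
    weilConv φ (weilReflect φ) = fun x ↦ ∫ u, φ u * conj (φ (u - x)) := by
  funext x
  rw [weilConv_apply]
  congr 1 with u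
  simp [weilReflect, neg_sub]

/-- For `φ ∈ K(a)` the kernel `φ ⋆ φ̃` is continuous (dominated convergence: for fixed `x₀` the
integrand `u ↦ φ(u) conj φ(u − x)` is continuous in `x` at `x₀` except for `u ∈ {x₀ ± a}`).
[cite: Yoshida1992HermitianForms, §1 p. 284 (admissible F: continuous)] -/
theorem continuous_weilConv_weilReflect_of_mem_K (h : φ ∈ K a) :
    Continuous (weilConv φ (weilReflect φ)) := by
  obtain ⟨C, hC0, hC⟩ := exists_bound_of_mem_K h
  have hφi := integrable_of_mem_K h
  have hφm := aestronglyMeasurable_of_mem_K h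
  rw [weilConv_weilReflect_eq, continuous_iff_continuousAt]
  intro x₀
  have hmeas : ∀ x : ℝ, AEStronglyMeasurable (fun u : ℝ ↦ φ u * conj (φ (u - x))) volume := by
    intro x
    refine hφm.mul (Complex.continuous_conj.comp_aestronglyMeasurable ?_)
    exact hφm.comp_quasiMeasurePreserving (measurePreserving_sub_right volume x).quasiMeasurePreserving
  refine continuousAt_of_dominated (bound := fun u ↦ C * ‖φ u‖) (Eventually.of_forall hmeas) ?_
    (hφi.norm.const_mul C) ?_
  · refine Eventually.of_forall fun x ↦ Eventually.of_forall fun u ↦ ?_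
    rw [norm_mul, Complex.norm_conj, mul_comm]
    exact mul_le_mul_of_nonneg_right (hC _) (norm_nonneg _)
  · have hnull : volume ({x₀ + a, x₀ - a} : Set ℝ) = 0 := (toFinite _).measure_zero volume
    have hae : ({x₀ + a, x₀ - a} : Set ℝ)ᶜ ∈ ae volume := compl_mem_ae_iff.2 hnull
    filter_upwards [hae] with u hu
    have hne : |u - x₀| ≠ a := by
      intro habs
      rcases abs_eq_abs.1 (habs.trans (abs_of_nonneg ((abs_nonneg _).trans_eq habs)).symm) with h1 | h1
      · exact hu (Or.inl (by linarith))
      · exact hu (Or.inr (by simp; linarith))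
    have h1 : ContinuousAt (fun x : ℝ ↦ u - x) x₀ := (continuous_const.sub continuous_id).continuousAt
    have h2 : ContinuousAt φ ((fun x : ℝ ↦ u - x) x₀) := continuousAt_of_mem_K h hne
    exact continuousAt_const.mul (Complex.continuous_conj.continuousAt.comp (h2.comp h1))

/-- For `φ ∈ K(a)` the kernel `φ ⋆ φ̃` has compact support. [cite: Yoshida1992HermitianForms, §2 p. 288 (supp F ⊆ [−2a, 2a])] -/
theorem hasCompactSupport_weilConv_weilReflect_of_mem_K (h : φ ∈ K a) :
    HasCompactSupport (weilConv φ (weilReflect φ)) := by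
  unfold weilConv
  exact (hasCompactSupport_of_mem_K h).convolution _ (hasCompactSupport_of_mem_K (weilReflect_mem_K h))

/-- For `φ ∈ K(a)`, `supp (φ ⋆ φ̃) ⊆ [−2a, 2a]`. [cite: Yoshida1992HermitianForms, §2 p. 288 (supp F ⊆ [−2a, 2a])] -/
theorem tsupport_weilConv_weilReflect_of_mem_K (h : φ ∈ K a) :
    tsupport (weilConv φ (weilReflect φ)) ⊆ Icc (-(2 * a)) (2 * a) :=
  tsupport_weilConv_weilReflect_subset (hasCompactSupport_of_mem_K h) (tsupport_subset_of_mem_K h)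

/-- `log(1 + |t|) ≤ 2 (1 + |t|)^{1/2}`. [folklore] -/
private theorem log_one_add_abs_le_two_mul_sqrt (t : ℝ) :
    Real.log (1 + |t|) ≤ 2 * (1 + |t|) ^ (1 / 2 : ℝ) := by
  have hu : 0 < 1 + |t| := by positivity
  have h1 : Real.log (1 + |t|) = 2 * Real.log ((1 + |t|) ^ (1 / 2 : ℝ)) := by
    rw [Real.log_rpow hu]; ring
  have h2 : Real.log ((1 + |t|) ^ (1 / 2 : ℝ)) ≤ (1 + |t|) ^ (1 / 2 : ℝ) - 1 :=
    Real.log_le_sub_one_of_pos (by positivity)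
  rw [h1]
  linarith

/-- **The archimedean integrand of `φ ⋆ φ̃` is integrable** for `φ ∈ K(a)`:
`|(φ ⋆ φ̃)^(½+it) Re ψ(¼+it/2)| = |φ̂|² |Re ψ| ≤ D (C + log(1+|t|))/(1+t²) ≪ (1+|t|)^{-3/2}`
(Yoshida §2: `F̂(t) = |φ̂(t)|² = O(t^{-2})` against `Re ψ = O(log t)`, the convergence of his `V₁`).
[cite: Yoshida1992HermitianForms, §2 p. 288, (2.1)] -/
theorem integrable_archIntegrand_of_mem_K (ha : 0 < a) (h : φ ∈ K a) :
    Integrable fun t : ℝ ↦ weilMellin (weilConv φ (weilReflect φ)) (1 / 2 + t * I) *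
      ((Complex.digamma (1 / 4 + t / 2 * I)).re : ℂ) := by
  obtain ⟨D, hD0, hD⟩ := exists_norm_sq_weilMellin_mul_le ha h
  obtain ⟨C, hC⟩ :=
    Literature.Analysis.SpecialFunctions.Complex.exists_norm_digamma_vertical_le
      (a := 1 / 4) (by norm_num)
  set ψr : ℝ → ℂ := fun t ↦ ((Complex.digamma (1 / 4 + t / 2 * I)).re : ℂ) with hψr
  have hw : ∀ t : ℝ, (1 / 4 : ℂ) + (t : ℂ) / 2 * I = ((1 / 4 : ℝ) : ℂ) + ((t / 2 : ℝ) : ℂ) * I := by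
    intro t
    push_cast
    ring
  have hψc : Continuous ψr := by
    refine continuous_ofReal.comp (Complex.continuous_re.comp ?_)
    refine Literature.Analysis.SpecialFunctions.Complex.continuousOn_digamma.comp_continuous
      (by fun_prop) fun t ↦ ?_
    rw [hw t]
    simp
  have hψb : ∀ t : ℝ, ‖ψr t‖ ≤ C + Real.log (1 + |t|) := by
    intro t
    have h1 : ‖ψr t‖ ≤ ‖Complex.digamma (1 / 4 + t / 2 * I)‖ := by
      simp only [hψr, Complex.norm_real, Real.norm_eq_abs]
      exact Complex.abs_re_le_norm _
    have h2 := hC (t / 2)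
    rw [← hw t] at h2
    have h3 : Real.log (1 + |t / 2|) ≤ Real.log (1 + |t|) := by
      refine Real.log_le_log (by positivity) ?_
      rw [abs_div, abs_two]
      linarith [abs_nonneg t]
    linarith
  have hFc := continuous_weilConv_weilReflect_of_mem_K h
  have hFs := hasCompactSupport_weilConv_weilReflect_of_mem_K h
  have hMc : Continuous fun t : ℝ ↦ weilMellin (weilConv φ (weilReflect φ)) (1 / 2 + t * I) := by
    have h := continuous_weilMellin_vertical hFc hFs (1 / 2)
    push_cast at h
    exact h
  refine Integrable.mono'
    ((integrable_one_add_norm (E := ℝ) (μ := volume) (r := 3 / 2) ?_).const_mul (2 * D * (|C| + 2)))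
    (hMc.mul hψc).aestronglyMeasurable (Eventually.of_forall fun t ↦ ?_)
  · rw [Module.finrank_self]; norm_num
  rw [norm_mul, weilMellin_weilConv_weilReflect_half_of_integrable (integrable_of_mem_K h),
    Complex.norm_real, Real.norm_of_nonneg (by positivity), Real.norm_eq_abs]
  set q : ℝ := ‖weilMellin φ (1 / 2 + t * I)‖ ^ 2 with hq
  set u : ℝ := 1 + |t| with hu
  have hupos : 0 < u := by positivity
  have hu1 : 1 ≤ u := by rw [hu]; linarith [abs_nonneg t]
  have hq0 : 0 ≤ q := by positivity
  have hqD : q * (1 + t ^ 2) ≤ D := hD t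
  have hus : 1 ≤ u ^ (1 / 2 : ℝ) := Real.one_le_rpow hu1 (by norm_num)
  have hψ : ‖ψr t‖ ≤ (|C| + 2) * u ^ (1 / 2 : ℝ) := by
    have h1 := hψb t
    have h2 := log_one_add_abs_le_two_mul_sqrt t
    have h3 : C ≤ |C| * u ^ (1 / 2 : ℝ) :=
      (le_abs_self C).trans (le_mul_of_one_le_right (abs_nonneg C) hus)
    rw [← hu] at h2
    linarith
  have ht2 : u ^ 2 ≤ 2 * (1 + t ^ 2) := by
    rw [hu]; nlinarith [sq_nonneg (|t| - 1), sq_abs t]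
  have hq' : q ≤ 2 * D / u ^ 2 := by
    rw [le_div_iff₀ (by positivity)]
    nlinarith
  have hrpow : u ^ (1 / 2 : ℝ) / u ^ 2 = u ^ (-(3 / 2) : ℝ) := by
    rw [show (u ^ 2 : ℝ) = u ^ (2 : ℝ) by norm_cast, ← Real.rpow_sub hupos]
    norm_num
  calc q * ‖ψr t‖ ≤ (2 * D / u ^ 2) * ((|C| + 2) * u ^ (1 / 2 : ℝ)) :=
        mul_le_mul hq' hψ (norm_nonneg _) (by positivity)
    _ = 2 * D * (|C| + 2) * (u ^ (1 / 2 : ℝ) / u ^ 2) := by ring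
    _ = 2 * D * (|C| + 2) * (1 + ‖t‖) ^ (-(3 / 2) : ℝ) := by
        rw [hrpow, Real.norm_eq_abs]

end SquareKernel

/-! ## §6 Non-negativity on `K(a)`: mollification from the `2/5` rung -/

section Nonneg

variable {a : ℝ} {φ : ℝ → ℂ}

/-- A test function is integrable and bounded. [folklore] -/
private theorem integrable_and_bdd_of_isWeilTest {g : ℝ → ℂ} (hg : IsWeilTest g) :
    Integrable g ∧ ∃ C, ∀ x, ‖g x‖ ≤ C :=
  integrable_and_bdd_of_continuous hg.1.continuous hg.2

/-- The mollifiers are invariant under the involution: `ρ̃_m = ρ_m` (real and even). [folklore] -/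
private theorem weilReflect_moll (m : ℕ) : weilReflect (moll m) = moll m := by
  funext x
  simp [weilReflect, moll, ContDiffBump.normed_neg]

/-- **`φ ⋆ ρ_m` is a Weil test function** for `φ ∈ K(a)` (smoothness of the convolution of a locally
integrable function with a smooth compactly supported one). [cite: Bombieri2000Weil, §3 (mollification)] -/
theorem isWeilTest_weilConv_moll_of_mem_K (h : φ ∈ K a) (m : ℕ) :
    IsWeilTest (weilConv φ (moll m)) := by
  rw [weilConv_eq_convolution_real]
  exact ⟨(hasCompactSupport_moll m).contDiff_convolution_right (ContinuousLinearMap.mul ℝ ℂ)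
      (locallyIntegrable_of_mem_K h) (contDiff_moll m),
    HasCompactSupport.convolution (L := ContinuousLinearMap.mul ℝ ℂ) (hasCompactSupport_of_mem_K h)
      (hasCompactSupport_moll m)⟩

/-- `supp (φ ⋆ ρ_m) ⊆ [−(a + r_m), a + r_m]`, `r_m = 1/(m+1)` the radius of `ρ_m`. [cite: Bombieri2000Weil, §3 (mollification)] -/
theorem tsupport_weilConv_moll_subset (h : φ ∈ K a) (m : ℕ) :
    tsupport (weilConv φ (moll m)) ⊆ Icc (-(a + (bump m).rOut)) (a + (bump m).rOut) := by
  refine (tsupport_weilConv_subset (hasCompactSupport_of_mem_K h)).trans ?_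
  rintro x ⟨u, hu, v, hv, rfl⟩
  have hu' := tsupport_subset_of_mem_K h hu
  have hv' := WeilSquareMollifier.tsupport_moll_subset m hv
  simp only [mem_Icc] at hu' hv' ⊢
  constructor <;> linarith [hu'.1, hu'.2, hv'.1, hv'.2]

/-- **The square of a mollified window function**: `(φ ⋆ ρ_m) ⋆ (φ ⋆ ρ_m)̃ = (φ ⋆ φ̃) ⋆ (ρ_m ⋆ ρ̃_m)`
(associativity and commutativity of `⋆`, `(f ⋆ g)̃ = f̃ ⋆ g̃`). [cite: Bombieri2000Weil, §3 (mollification)] -/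
theorem weilConv_moll_sq (h : φ ∈ K a) (m : ℕ) :
    weilConv (weilConv φ (moll m)) (weilReflect (weilConv φ (moll m))) =
      weilConv (weilConv φ (weilReflect φ)) (weilConv (moll m) (weilReflect (moll m))) := by
  have hφi := integrable_of_mem_K h
  obtain ⟨Cφ', -, hφ'b⟩ := exists_bound_of_mem_K (weilReflect_mem_K h)
  have hφ'i := integrable_of_mem_K (weilReflect_mem_K h)
  obtain ⟨hρi, hρb⟩ := integrable_and_bdd_of_isWeilTest (isWeilTest_moll m)
  -- `φ̃ ⋆ ρ` and `ρ ⋆ ρ` are test functions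
  obtain ⟨hwi, hwb⟩ := integrable_and_bdd_of_isWeilTest
    (isWeilTest_weilConv_moll_of_mem_K (weilReflect_mem_K h) m)
  obtain ⟨hνi, hνb⟩ := integrable_and_bdd_of_isWeilTest ((isWeilTest_moll m).weilConv (isWeilTest_moll m))
  rw [weilReflect_weilConv, weilReflect_moll,
    weilConv_assoc hφi hρi hwi hρb hwb, ← weilConv_assoc hρi hφ'i hρi ⟨Cφ', hφ'b⟩ hρb,
    weilConv_comm (moll m) (weilReflect φ), weilConv_assoc hφ'i hρi hρi hρb hρb,
    ← weilConv_assoc hφi hφ'i hνi ⟨Cφ', hφ'b⟩ hνb]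

/-- **`Q(φ ⋆ ρ_{m+1}) → Q(φ)`** for `φ ∈ K(a)`: `Q(φ ⋆ ρ) = W((φ ⋆ φ̃) ⋆ (ρ ⋆ ρ̃))` and the squares
`ρ_m ⋆ ρ̃_m` form an approximate identity (`WeilApproxIdentity.tendsto_weilFunctional`; the index is
shifted by one so that the supports `[−2/(m+2), 2/(m+2)]` have radius `≤ 1`). [cite: Bombieri2000Weil, §3 (mollification)] -/
theorem tendsto_weilQuadratic_weilConv_moll (ha : 0 < a) (h : φ ∈ K a) :
    Tendsto (fun m : ℕ ↦ weilQuadratic (weilConv φ (moll (m + 1)))) atTop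
      (𝓝 (weilQuadratic φ)) := by
  have hδ : Tendsto (fun n : ℕ ↦ 2 * (bump (n + 1)).rOut) atTop (𝓝 0) :=
    WeilSquareMollifier.tendsto_two_mul_bump_rOut.comp (tendsto_add_atTop_nat 1)
  have hδ1 : ∀ n : ℕ, 2 * (bump (n + 1)).rOut ≤ 1 := by
    intro n
    rw [WeilSquareMollifier.two_mul_bump_rOut, div_le_one (by positivity)]
    push_cast
    linarith [(Nat.cast_nonneg n : (0 : ℝ) ≤ n)]
  have key := WeilApproxIdentity.tendsto_weilFunctional (g := weilConv φ (weilReflect φ))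
    (u := fun n ↦ weilConv (moll (n + 1)) (weilReflect (moll (n + 1))))
    (δ := fun n ↦ 2 * (bump (n + 1)).rOut)
    (fun n ↦ WeilSquareMollifier.continuous_sqMoll (n + 1)) hδ hδ1
    (fun n x hx ↦ WeilSquareMollifier.sqMoll_eq_zero hx)
    (fun n ↦ WeilSquareMollifier.integral_sqMoll (n + 1))
    (fun n ↦ WeilSquareMollifier.integral_norm_sqMoll (n + 1))
    (continuous_weilConv_weilReflect_of_mem_K h) (hasCompactSupport_weilConv_weilReflect_of_mem_K h)
    (integrable_archIntegrand_of_mem_K ha h)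
  unfold weilQuadratic
  refine key.congr fun m ↦ ?_
  rw [weilConv_moll_sq h]

/-- Eventually the mollified window function is supported in `[−b, b]` for any `b > a`. [folklore] -/
private theorem eventually_tsupport_weilConv_moll_subset (h : φ ∈ K a) {b : ℝ} (hab : a < b) :
    ∀ᶠ m : ℕ in atTop, tsupport (weilConv φ (moll (m + 1))) ⊆ Icc (-b) b := by
  have hev : ∀ᶠ m : ℕ in atTop, (bump (m + 1)).rOut < b - a :=
    (tendsto_order.1 (tendsto_bump_rOut.comp (tendsto_add_atTop_nat 1))).2 _ (by linarith)
  filter_upwards [hev] with m hm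
  exact (tsupport_weilConv_moll_subset h (m + 1)).trans (Icc_subset_Icc (by linarith) (by linarith))

/-- **Yoshida's (6.1) on `K(a)` for every window `a < 2/5`** (in particular `a = log 2/2`):
`Re Q(φ) ≥ 0` for `φ ∈ K(a)` — the limit of `Re Q(φ ⋆ ρ_m) ≥ 0` (`weilPositivityOn_two_fifths`).
[cite: Yoshida1992HermitianForms, §6 (6.1) p. 302 and Theorem 1 p. 310] -/
theorem weilQuadratic_re_nonneg_of_mem_K (ha : 0 < a) (ha' : a < 2 / 5) (h : φ ∈ K a) :
    0 ≤ (weilQuadratic φ).re := by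
  have hre : Tendsto (fun m : ℕ ↦ (weilQuadratic (weilConv φ (moll (m + 1)))).re) atTop
      (𝓝 (weilQuadratic φ).re) :=
    (Complex.continuous_re.tendsto _).comp (tendsto_weilQuadratic_weilConv_moll ha h)
  refine ge_of_tendsto hre ?_
  filter_upwards [eventually_tsupport_weilConv_moll_subset h ha'] with m hm
  exact weilPositivityOn_two_fifths _ (isWeilTest_weilConv_moll_of_mem_K h _) hm

end Nonneg

/-! ## §7 The cross terms: `Re Q(φ) = 0` forces `W(φ ⋆ ψ̃) = 0` (Cauchy–Schwarz) -/

section CrossTerms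

variable {a : ℝ} {φ : ℝ → ℂ}

/-- **Conjugation and the involution**: `conj W(k) = W(k̃)` for every `k : ℝ → ℂ` (each of the three
terms: `(k̃)^(s) = conj k̂(1 − s̄)` swaps `k̂(0), k̂(1)`; the prime summands and the archimedean integrand
are conjugated; no hypotheses — both sides carry the same junk values; compare the tree's
`conj_weilFunctional_of_selfAdjoint`). [cite: Bombieri2000Weil, §§2–3 (the form T[f * ḡ*] is hermitian)] -/
theorem conj_weilFunctional (k : ℝ → ℂ) :
    conj (weilFunctional k) = weilFunctional (weilReflect k) := by
  have hM : ∀ s, weilMellin (weilReflect k) s = conj (weilMellin k (1 - conj s)) :=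
    weilMellin_weilReflect_holds k
  have hP : conj (weilPolarTerm k) = weilPolarTerm (weilReflect k) := by
    rw [weilPolarTerm, weilPolarTerm, map_add, hM 0, hM 1, map_zero, sub_zero, map_one, sub_self,
      add_comm]
  have hΛ : conj (weilPrimeTerm k) = weilPrimeTerm (weilReflect k) := by
    rw [weilPrimeTerm, weilPrimeTerm, Complex.conj_tsum]
    refine tsum_congr fun n ↦ ?_
    simp only [map_mul, map_div₀, Complex.conj_ofReal, map_add, weilReflect, neg_neg]
    ring
  have hhalf : ∀ t : ℝ, (1 : ℂ) - conj (1 / 2 + (t : ℂ) * I) = 1 / 2 + (t : ℂ) * I := fun t ↦ by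
    apply Complex.ext <;> norm_num
  have hA : conj (weilArchTerm k) = weilArchTerm (weilReflect k) := by
    rw [weilArchTerm, weilArchTerm, map_sub, map_mul, map_mul, weilArchIntegral, weilArchIntegral,
      ← integral_conj]
    have h0 : weilReflect k 0 = conj (k 0) := by simp [weilReflect]
    rw [h0, Complex.conj_ofReal]
    congr 2
    · rw [map_div₀, map_one, map_mul, map_ofNat, Complex.conj_ofReal]
    · refine integral_congr_ae (Eventually.of_forall fun t ↦ ?_)
      dsimp only
      rw [map_mul, Complex.conj_ofReal, hM, hhalf]
  rw [weilFunctional, weilFunctional, map_add, map_sub, hP, hΛ, hA]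

/-- `ψ ⋆ g̃ = (g ⋆ ψ̃)̃` (no hypotheses). [folklore] -/
private theorem weilConv_weilReflect_swap (g ψ : ℝ → ℂ) :
    weilConv ψ (weilReflect g) = weilReflect (weilConv g (weilReflect ψ)) := by
  rw [weilReflect_weilConv, weilReflect_weilReflect, weilConv_comm]

/-- `φ ⋆ ψ̃` is a Weil test function for `φ ∈ K(a)` and a test `ψ`. [cite: Bombieri2000Weil, §3 (mollification)] -/
theorem isWeilTest_weilConv_weilReflect_of_mem_K (h : φ ∈ K a) {ψ : ℝ → ℂ} (hψ : IsWeilTest ψ) :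
    IsWeilTest (weilConv φ (weilReflect ψ)) := by
  rw [weilConv_eq_convolution_real]
  exact ⟨hψ.weilReflect.2.contDiff_convolution_right (ContinuousLinearMap.mul ℝ ℂ)
      (locallyIntegrable_of_mem_K h) hψ.weilReflect.1,
    HasCompactSupport.convolution (L := ContinuousLinearMap.mul ℝ ℂ) (hasCompactSupport_of_mem_K h)
      hψ.weilReflect.2⟩

/-- `(φ ⋆ ρ_m) ⋆ ψ̃ = (φ ⋆ ψ̃) ⋆ ρ_m`. [cite: Bombieri2000Weil, §3 (mollification)] -/
theorem weilConv_weilConv_moll_weilReflect (h : φ ∈ K a) {ψ : ℝ → ℂ} (hψ : IsWeilTest ψ) (m : ℕ) :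
    weilConv (weilConv φ (moll m)) (weilReflect ψ) = weilConv (weilConv φ (weilReflect ψ)) (moll m) := by
  have hφi := integrable_of_mem_K h
  obtain ⟨hρi, hρb⟩ := integrable_and_bdd_of_isWeilTest (isWeilTest_moll m)
  obtain ⟨hψ'i, hψ'b⟩ := integrable_and_bdd_of_isWeilTest hψ.weilReflect
  rw [weilConv_assoc hφi hρi hψ'i hρb hψ'b, weilConv_comm (moll m) (weilReflect ψ),
    ← weilConv_assoc hφi hψ'i hρi hψ'b hρb]

/-- The polarisation inequality on the `2/5` window: for `φ ∈ K(a)`, `a < 2/5`, a test `ψ` supported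
in `[−2/5, 2/5]`, `λ ∈ ℂ` and all large `m`,
`0 ≤ Re Q(φ ⋆ ρ_{m+1}) + |λ|² Re Q(ψ) + 2 Re(λ̄ · W((φ ⋆ ρ_{m+1}) ⋆ ψ̃))`
(`weilQuadratic_add`, `conj W(k) = W(k̃)`, `weilPositivityOn_two_fifths`).
[cite: Yoshida1992HermitianForms, §2 p. 287 (the hermitian form (φ₁, φ₂) = T(φ₁ * φ̃₂))] -/
theorem eventually_polarisation_nonneg (ha' : a < 2 / 5) (h : φ ∈ K a) {ψ : ℝ → ℂ}
    (hψ : IsWeilTest ψ) (hψs : tsupport ψ ⊆ Icc (-(2 / 5 : ℝ)) (2 / 5)) (l : ℂ) :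
    ∀ᶠ m : ℕ in atTop, 0 ≤ (weilQuadratic (weilConv φ (moll (m + 1)))).re +
      Complex.normSq l * (weilQuadratic ψ).re +
      2 * (conj l * weilFunctional (weilConv (weilConv φ (moll (m + 1))) (weilReflect ψ))).re := by
  filter_upwards [eventually_tsupport_weilConv_moll_subset h ha'] with m hm
  set g := weilConv φ (moll (m + 1)) with hg_def
  have hg : IsWeilTest g := isWeilTest_weilConv_moll_of_mem_K h _
  have hlψ : IsWeilTest (fun t ↦ l * ψ t) := hψ.const_mul l
  have hsupp : tsupport (g + fun t ↦ l * ψ t) ⊆ Icc (-(2 / 5 : ℝ)) (2 / 5) := by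
    refine (closure_mono (Function.support_add _ _)).trans ?_
    rw [closure_union]
    exact union_subset hm ((tsupport_mul_subset_right).trans hψs)
  have hpos : 0 ≤ (weilQuadratic (g + fun t ↦ l * ψ t)).re :=
    weilPositivityOn_two_fifths _ (hg.add hlψ) hsupp
  rw [weilQuadratic_add hg hlψ, weilQuadratic_const_mul, weilReflect_const_mul,
    weilConv_const_mul_right, weilFunctional_const_mul, weilConv_const_mul_left,
    weilFunctional_const_mul] at hpos
  have hw : l * weilFunctional (weilConv ψ (weilReflect g)) =
      conj (conj l * weilFunctional (weilConv g (weilReflect ψ))) := by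
    rw [weilConv_weilReflect_swap g ψ, ← conj_weilFunctional, map_mul, Complex.conj_conj]
  rw [hw, Complex.add_conj] at hpos
  simpa [Complex.add_re, Complex.re_ofReal_mul] using hpos

/-- **Cauchy–Schwarz step.** For `φ ∈ K(a)` (`0 < a < 2/5`) with `Re Q(φ) = 0` and every test `ψ`
supported in `[−2/5, 2/5]`: `W(φ ⋆ ψ̃) = 0`. Proof: let `m → ∞` in `eventually_polarisation_nonneg`
(`Q(φ ⋆ ρ_m) → Q(φ)`, `W((φ ⋆ ρ_m) ⋆ ψ̃) = W((φ ⋆ ψ̃) ⋆ ρ_m) → W(φ ⋆ ψ̃)`), then choose `λ = −t·W(φ ⋆ ψ̃)`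
with `t > 0` small. [cite: Yoshida1992HermitianForms, §3 Proposition 2 p. 291 (the radical V₀)] -/
theorem weilFunctional_weilConv_weilReflect_eq_zero_of_re_eq_zero (ha : 0 < a) (ha' : a < 2 / 5)
    (h : φ ∈ K a) (hQ : (weilQuadratic φ).re = 0) {ψ : ℝ → ℂ} (hψ : IsWeilTest ψ)
    (hψs : tsupport ψ ⊆ Icc (-(2 / 5 : ℝ)) (2 / 5)) :
    weilFunctional (weilConv φ (weilReflect ψ)) = 0 := by
  set z : ℂ := weilFunctional (weilConv φ (weilReflect ψ)) with hz_def
  set q : ℝ := (weilQuadratic ψ).re with hq_def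
  have hG := isWeilTest_weilConv_weilReflect_of_mem_K h hψ
  -- the two limits
  have hlimQ : Tendsto (fun m : ℕ ↦ (weilQuadratic (weilConv φ (moll (m + 1)))).re) atTop (𝓝 0) := by
    rw [← hQ]
    exact (Complex.continuous_re.tendsto _).comp (tendsto_weilQuadratic_weilConv_moll ha h)
  have hlimz : Tendsto (fun m : ℕ ↦
      weilFunctional (weilConv (weilConv φ (moll (m + 1))) (weilReflect ψ))) atTop (𝓝 z) := by
    have hT := (tendsto_weilFunctional_moll hG.1.continuous hG.2 (integrable_weilArchIntegrand hG)).comp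
      (tendsto_add_atTop_nat 1)
    refine hT.congr fun m ↦ ?_
    simp only [Function.comp_apply]
    rw [weilConv_weilConv_moll_weilReflect h hψ]
  -- the limiting inequality for every `λ`
  have hlim : ∀ l : ℂ, 0 ≤ Complex.normSq l * q + 2 * (conj l * z).re := by
    intro l
    have hT : Tendsto (fun m : ℕ ↦ (weilQuadratic (weilConv φ (moll (m + 1)))).re +
        Complex.normSq l * q +
        2 * (conj l * weilFunctional (weilConv (weilConv φ (moll (m + 1))) (weilReflect ψ))).re)
        atTop (𝓝 (0 + Complex.normSq l * q + 2 * (conj l * z).re)) :=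
      (hlimQ.add_const _).add
        (((Complex.continuous_re.tendsto _).comp (hlimz.const_mul (conj l))).const_mul 2)
    have := ge_of_tendsto hT (eventually_polarisation_nonneg ha' h hψ hψs l)
    linarith
  -- choose `λ = -t z`, `t = 1/(|q| + 1)`
  by_contra hz
  have hz2 : 0 < Complex.normSq z := Complex.normSq_pos.2 hz
  set t : ℝ := 1 / (|q| + 1) with ht_def
  have ht : 0 < t := by positivity
  have htq : t * q < 1 := by
    rw [ht_def]
    have h1 : 1 / (|q| + 1) * q ≤ 1 / (|q| + 1) * |q| :=
      mul_le_mul_of_nonneg_left (le_abs_self q) (by positivity)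
    have h2 : 1 / (|q| + 1) * |q| < 1 := by
      rw [div_mul_eq_mul_div, one_mul, div_lt_one (by positivity)]
      linarith
    linarith
  have h1 := hlim (-(t : ℂ) * z)
  have hns : Complex.normSq (-(t : ℂ) * z) = t ^ 2 * Complex.normSq z := by
    rw [Complex.normSq_mul, Complex.normSq_neg, Complex.normSq_ofReal]; ring
  have hre : (conj (-(t : ℂ) * z) * z).re = -(t * Complex.normSq z) := by
    rw [map_mul, map_neg, Complex.conj_ofReal, mul_assoc, ← Complex.normSq_eq_conj_mul_self,
      show -(t : ℂ) * ((Complex.normSq z : ℝ) : ℂ) = ((-(t * Complex.normSq z) : ℝ) : ℂ) by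
        push_cast; ring, Complex.ofReal_re]
  rw [hns, hre] at h1
  -- `0 ≤ t² |z|² q − 2 t |z|² = t |z|² (t q − 2)` with `t |z|² > 0` forces `t q ≥ 2`
  have h3 : 0 < t * Complex.normSq z := mul_pos ht hz2
  have h4 : 0 ≤ t * q - 2 := by
    by_contra hlt
    have := mul_neg_of_pos_of_neg h3 (sub_neg.2 (not_le.1 (by simpa [sub_nonneg] using hlt)))
    nlinarith
  linarith

end CrossTerms

/-! ## §8 Yoshida's Proposition 2: the Weil form is non-degenerate on `C(c)` -/

section PropositionTwo

/-- **Yoshida 1992, Proposition 2** (p. 291): "For any `a > 0`, the restriction of the hermitian form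
`( , )` to `C(a)` is non-degenerate."  In the tree's vocabulary: a test function `g` with
`tsupport g ⊆ [−c, c]` (`c > 0`) such that `W(g ⋆ ψ̃) = 0` for every test function `ψ` with
`tsupport ψ ⊆ [−c, c]` is zero.  Proof as printed (p. 291): the radical `V₀` meets the coercive
finite-codimension subspace of Lemma 3 trivially — here the tree's fine-grid Lemma 3
`weilQuadratic_re_ge_of_grid_zero` (`Q(u) = (u, u) = 0` on `V₀`, so `∫|u|² ≤ Re Q(u) = 0` once
`û` vanishes on the grid) — hence `V₀` is finite-dimensional; `V₀` is stable under `d/dx`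
(`(u′, ψ) = −(u, ψ′)`); so `d/dx` has an eigenvector `w ∈ V₀`, `w′ = μw`, i.e. `w = C e^{μx}`,
which is compactly supported only if `w = 0` — a contradiction (Yoshida: "a non-zero solution of
(3.2) cannot belong to `C_c^∞(ℝ)`"). [cite: Yoshida1992HermitianForms, §3 Proposition 2 p. 291] -/
theorem proposition2 {c : ℝ} (hc : 0 < c) {g : ℝ → ℂ} (hg : IsWeilTest g)
    (hgs : tsupport g ⊆ Icc (-c) c)
    (hrad : ∀ ψ : ℝ → ℂ, IsWeilTest ψ → tsupport ψ ⊆ Icc (-c) c →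
      weilFunctional (weilConv g (weilReflect ψ)) = 0) :
    g = 0 := by
  classical
  -- the radical `V₀` of the form on `C(c)`, as a complex vector space of functions
  let V : Submodule ℂ (ℝ → ℂ) :=
    { carrier := {u | IsWeilTest u ∧ tsupport u ⊆ Icc (-c) c ∧
        ∀ ψ : ℝ → ℂ, IsWeilTest ψ → tsupport ψ ⊆ Icc (-c) c →
          weilFunctional (weilConv u (weilReflect ψ)) = 0}
      add_mem' := by
        rintro u v ⟨hu, hus, hu0⟩ ⟨hv, hvs, hv0⟩
        refine ⟨hu.add hv, ?_, fun ψ hψ hψs ↦ ?_⟩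
        · exact (closure_mono (Function.support_add u v)).trans
            (by rw [closure_union]; exact union_subset hus hvs)
        · rw [weilConv_add_left hu hv hψ.weilReflect,
            weilFunctional_add (hu.weilConv hψ.weilReflect) (hv.weilConv hψ.weilReflect),
            hu0 ψ hψ hψs, hv0 ψ hψ hψs, add_zero]
      zero_mem' := by
        refine ⟨⟨contDiff_const, HasCompactSupport.of_support_subset_isCompact isCompact_empty
          (by simp)⟩, by simp, fun ψ hψ hψs ↦ ?_⟩
        have h0 : (0 : ℝ → ℂ) = fun t ↦ (0 : ℂ) * ψ t := by funext t; simp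
        rw [h0, weilConv_const_mul_left, weilFunctional_const_mul, zero_mul]
      smul_mem' := by
        rintro l u ⟨hu, hus, hu0⟩
        have hl : l • u = fun t ↦ l * u t := by funext t; simp
        rw [hl]
        refine ⟨hu.const_mul l, tsupport_mul_subset_right.trans hus, fun ψ hψ hψs ↦ ?_⟩
        rw [weilConv_const_mul_left, weilFunctional_const_mul, hu0 ψ hψ hψs, mul_zero] }
  have hmemV : ∀ {u : ℝ → ℂ}, u ∈ V ↔ IsWeilTest u ∧ tsupport u ⊆ Icc (-c) c ∧
      ∀ ψ : ℝ → ℂ, IsWeilTest ψ → tsupport ψ ⊆ Icc (-c) c →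
        weilFunctional (weilConv u (weilReflect ψ)) = 0 := Iff.rfl
  -- `V₀` is stable under `d/dx`: `(u′, ψ) = −(u, ψ′)`
  have hD : ∀ u ∈ V, deriv u ∈ V := by
    intro u huV
    obtain ⟨hu, hus, hu0⟩ := hmemV.1 huV
    refine hmemV.2 ⟨hu.deriv, tsupport_deriv_subset.trans hus, fun ψ hψ hψs ↦ ?_⟩
    have h1 : weilConv (deriv u) (weilReflect ψ) =
        fun t ↦ (-1 : ℂ) * weilConv u (weilReflect (deriv ψ)) t := by
      rw [← ConnesVanSuijlekom.deriv_weilConv_left hu hψ.weilReflect.1.continuous,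
        ConnesVanSuijlekom.deriv_weilConv_right hu.1.continuous hψ.weilReflect]
      have e : deriv (weilReflect ψ) = fun t ↦ (-1 : ℂ) * weilReflect (deriv ψ) t := by
        funext t
        rw [congr_fun (ConnesVanSuijlekom.weilReflect_deriv ψ) t]
        ring
      rw [e, weilConv_const_mul_right]
    rw [h1, weilFunctional_const_mul, hu0 (deriv ψ) hψ.deriv (tsupport_deriv_subset.trans hψs),
      mul_zero]
  -- `V₀` is finite-dimensional (Lemma 3, fine-grid form: `∫|u|² ≤ Re Q(u)` once `û` vanishes on a grid)
  obtain ⟨T, -, N, -, hcoer⟩ := weilQuadratic_re_ge_of_grid_zero hc 1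
  let L : V →ₗ[ℂ] (Fin (N + 1) → ℂ) :=
    { toFun := fun u j ↦
        weilMellin (u : ℝ → ℂ) (1 / 2 + ((-T + (j : ℕ) * (2 * T / N) : ℝ) : ℂ) * I)
      map_add' := by
        intro u v
        funext j
        obtain ⟨hu, -, -⟩ := hmemV.1 u.2
        obtain ⟨hv, -, -⟩ := hmemV.1 v.2
        simp only [Submodule.coe_add, Pi.add_apply]
        exact weilMellin_add hu.1.continuous hu.2 hv.1.continuous hv.2 _
      map_smul' := by
        intro l u
        funext j
        simp only [Submodule.coe_smul, Pi.smul_apply, smul_eq_mul, RingHom.id_apply]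
        have hl : (l • (u : ℝ → ℂ)) = fun t ↦ l * (u : ℝ → ℂ) t := by funext t; simp
        rw [hl, weilMellin_const_mul] }
  have hLinj : Function.Injective L := by
    refine (injective_iff_map_eq_zero L).2 fun u hu ↦ ?_
    obtain ⟨huT, hus, hu0⟩ := hmemV.1 u.2
    have hgrid : ∀ j : ℕ, j ≤ N →
        weilMellin (u : ℝ → ℂ) (1 / 2 + ((-T + j * (2 * T / N) : ℝ) : ℂ) * I) = 0 := by
      intro j hj
      have := congr_fun hu ⟨j, Nat.lt_succ_of_le hj⟩
      simpa [L] using this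
    have hQ : (weilQuadratic (u : ℝ → ℂ)).re = 0 := by
      unfold weilQuadratic
      rw [hu0 u huT hus, Complex.zero_re]
    have hle := hcoer u huT hus hgrid
    rw [hQ, one_mul] at hle
    have hint : ∫ t : ℝ, ‖(u : ℝ → ℂ) t‖ ^ 2 = 0 :=
      le_antisymm hle (integral_nonneg fun t ↦ by positivity)
    exact Subtype.ext (huT.eq_zero_of_integral_norm_sq_eq_zero hint)
  haveI : FiniteDimensional ℂ V := Module.Finite.of_injective L hLinj
  -- `d/dx` as an endomorphism of `V₀`
  let D : V →ₗ[ℂ] V :=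
    { toFun := fun u ↦ ⟨deriv (u : ℝ → ℂ), hD u u.2⟩
      map_add' := by
        intro u v
        apply Subtype.ext
        obtain ⟨hu, -, -⟩ := hmemV.1 u.2
        obtain ⟨hv, -, -⟩ := hmemV.1 v.2
        simp only [Submodule.coe_add]
        funext t
        exact deriv_add ((hu.1.differentiable (by simp)) t) ((hv.1.differentiable (by simp)) t)
      map_smul' := by
        intro l u
        apply Subtype.ext
        obtain ⟨hu, -, -⟩ := hmemV.1 u.2
        simp only [Submodule.coe_smul, RingHom.id_apply]
        funext t
        exact deriv_const_smul l ((hu.1.differentiable (by simp)) t) }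
  -- if `g ≠ 0` then `V₀ ≠ 0` and `d/dx` has an eigenvector `w ∈ V₀`: `w′ = μ w`
  by_contra hg0
  have hgV : g ∈ V := hmemV.2 ⟨hg, hgs, hrad⟩
  haveI : Nontrivial V := ⟨⟨⟨g, hgV⟩, 0, fun h ↦ hg0 (congrArg Subtype.val h)⟩⟩
  obtain ⟨μ, hμ⟩ := Module.End.exists_eigenvalue D
  obtain ⟨w, hw⟩ := hμ.exists_hasEigenvector
  have hwD : D w = μ • w := hw.apply_eq_smul
  have hw0 : w ≠ 0 := (Module.End.hasEigenvector_iff.1 hw).2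
  obtain ⟨hwt, hws, -⟩ := hmemV.1 w.2
  have hdiff : Differentiable ℝ (w : ℝ → ℂ) := hwt.1.differentiable (by simp)
  have hderiv : ∀ t, deriv (w : ℝ → ℂ) t = μ * (w : ℝ → ℂ) t := by
    intro t
    have := congrArg (fun v : V ↦ (v : ℝ → ℂ) t) hwD
    simpa [D] using this
  -- `t ↦ w(t) e^{−μt}` has zero derivative, hence is constant; `w(c + 1) = 0`
  set E : ℝ → ℂ := fun t ↦ (w : ℝ → ℂ) t * cexp (-(μ * t)) with hE
  have hEd : ∀ t, deriv E t = 0 := by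
    intro t
    have h1 : HasDerivAt (w : ℝ → ℂ) (μ * (w : ℝ → ℂ) t) t := by
      rw [← hderiv t]; exact (hdiff t).hasDerivAt
    have h2 : HasDerivAt (fun s : ℝ ↦ cexp (-(μ * s))) (cexp (-(μ * t)) * -(μ * 1)) t := by
      have h3 : HasDerivAt (fun s : ℝ ↦ -(μ * (s : ℂ))) (-(μ * 1)) t :=
        ((hasDerivAt_id t).ofReal_comp.const_mul μ).neg
      exact h3.cexp
    have hE' : HasDerivAt E (μ * (w : ℝ → ℂ) t * cexp (-(μ * t)) +
        (w : ℝ → ℂ) t * (cexp (-(μ * t)) * -(μ * 1))) t := h1.mul h2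
    rw [hE'.deriv]
    ring
  have hEdiff : Differentiable ℝ E := hdiff.mul (by fun_prop)
  have hEconst := is_const_of_deriv_eq_zero hEdiff hEd
  have hwc : (w : ℝ → ℂ) (c + 1) = 0 := by
    apply image_eq_zero_of_notMem_tsupport
    intro hmem
    have := hws hmem
    simp only [mem_Icc] at this
    linarith [this.2]
  have hw_zero : (w : ℝ → ℂ) = 0 := by
    funext t
    have h := hEconst t (c + 1)
    simp only [hE, hwc, zero_mul, mul_eq_zero, Complex.exp_ne_zero, or_false] at h
    exact h
  exact hw0 (Subtype.ext hw_zero)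

end PropositionTwo

/-! ## §9 Assembly: the smoothing step and Theorem 1 -/

section Assembly

variable {a : ℝ} {φ : ℝ → ℂ}

/-- **Approximate identity at a point of continuity**: `(φ ⋆ ρ_k)(x) → φ(x)` for integrable `φ`
continuous at `x` (the tree's `WeilContinuous.tendsto_weilConv_moll` for continuous `φ`).
[cite: Bombieri2000Weil, §3 (mollification)] -/
theorem tendsto_weilConv_moll_of_continuousAt (hφi : Integrable φ) {x : ℝ} (hx : ContinuousAt φ x) :
    Tendsto (fun k ↦ weilConv φ (moll k) x) atTop (𝓝 (φ x)) := by
  rw [Metric.tendsto_nhds]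
  intro ε hε
  obtain ⟨δ, hδ, hδg⟩ := Metric.continuousAt_iff.1 hx (ε / 2) (by positivity)
  have hk : ∀ᶠ k : ℕ in atTop, (bump k).rOut < δ := (tendsto_order.1 tendsto_bump_rOut).2 δ hδ
  filter_upwards [hk] with k hk
  have hconv : weilConv φ (moll k) x = ∫ u : ℝ, φ u * moll k (x - u) := weilConv_apply φ (moll k) x
  have hone : ∫ u : ℝ, moll k (x - u) = 1 := by
    rw [integral_sub_left_eq_self (fun u ↦ moll k u) volume x, integral_moll]
  have hgx : φ x = ∫ u : ℝ, φ x * moll k (x - u) := by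
    rw [MeasureTheory.integral_const_mul, hone, mul_one]
  have hmc : Continuous fun u : ℝ ↦ moll k (x - u) := (continuous_moll k).comp (by fun_prop)
  obtain ⟨Cρ, hCρ⟩ := (continuous_moll k).bounded_above_of_compact_support (hasCompactSupport_moll k)
  have hint1 : Integrable fun u : ℝ ↦ φ u * moll k (x - u) :=
    hφi.mul_bdd hmc.aestronglyMeasurable (Eventually.of_forall fun u ↦ hCρ _)
  have hint2 : Integrable fun u : ℝ ↦ φ x * moll k (x - u) :=
    (hmc.integrable_of_hasCompactSupport
      ((hasCompactSupport_moll k).comp_homeomorph (Homeomorph.subLeft x))).const_mul _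
  rw [dist_eq_norm, hconv, hgx, ← integral_sub hint1 hint2]
  have hb : ∀ u : ℝ, ‖φ u * moll k (x - u) - φ x * moll k (x - u)‖ ≤ ε / 2 * ‖moll k (x - u)‖ := by
    intro u
    rw [← sub_mul, norm_mul]
    rcases le_or_gt (bump k).rOut |x - u| with hu | hu
    · rw [moll_eq_zero hu]; simp
    · refine mul_le_mul_of_nonneg_right ?_ (norm_nonneg _)
      have hdist : dist u x < δ := by
        rw [dist_comm, Real.dist_eq]; exact hu.trans hk
      exact le_of_lt (by simpa [dist_eq_norm] using hδg hdist)
  calc ‖∫ u : ℝ, (φ u * moll k (x - u) - φ x * moll k (x - u))‖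
      ≤ ∫ u : ℝ, ‖φ u * moll k (x - u) - φ x * moll k (x - u)‖ := norm_integral_le_integral_norm _
    _ ≤ ∫ u : ℝ, ε / 2 * ‖moll k (x - u)‖ :=
        integral_mono_of_nonneg (Eventually.of_forall fun _ ↦ norm_nonneg _)
          (((integrable_norm_moll k).comp_sub_left x).const_mul _) (Eventually.of_forall hb)
    _ = ε / 2 := by
        rw [MeasureTheory.integral_const_mul, integral_sub_left_eq_self (fun u ↦ ‖moll k u‖) volume x,
          integral_norm_moll, mul_one]
    _ < ε := by linarith

/-- **The smoothing step.** For `φ ∈ K(a)`, `0 < a < 2/5`, with `Re Q(φ) = 0`: `φ ⋆ ρ_m = 0` for all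
large `m` — the test function `φ ⋆ ρ_m` lies in the radical of the form on `C(a + r_m)`
(`((φ ⋆ ρ_m) ⋆ ψ̃ = φ ⋆ (ψ ⋆ ρ_m)̃` and the Cauchy–Schwarz step), which is zero by Proposition 2.
[cite: Yoshida1992HermitianForms, §3 Proposition 2 p. 291] -/
theorem eventually_weilConv_moll_eq_zero (ha : 0 < a) (ha' : a < 2 / 5) (h : φ ∈ K a)
    (hQ : (weilQuadratic φ).re = 0) : ∀ᶠ m : ℕ in atTop, weilConv φ (moll m) = 0 := by
  have hev : ∀ᶠ m : ℕ in atTop, (bump m).rOut < (2 / 5 - a) / 2 :=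
    (tendsto_order.1 tendsto_bump_rOut).2 _ (by linarith)
  filter_upwards [hev] with m hm
  have hr : 0 < (bump m).rOut := (bump m).rOut_pos
  have hφi := integrable_of_mem_K h
  obtain ⟨hρi, hρb⟩ := integrable_and_bdd_of_isWeilTest (isWeilTest_moll m)
  refine proposition2 (c := a + (bump m).rOut) (by linarith) (isWeilTest_weilConv_moll_of_mem_K h m)
    (tsupport_weilConv_moll_subset h m) fun ψ hψ hψs ↦ ?_
  obtain ⟨hψ'i, hψ'b⟩ := integrable_and_bdd_of_isWeilTest hψ.weilReflect
  have e : weilConv (weilConv φ (moll m)) (weilReflect ψ) =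
      weilConv φ (weilReflect (weilConv ψ (moll m))) := by
    rw [weilReflect_weilConv, weilReflect_moll, weilConv_assoc hφi hρi hψ'i hρb hψ'b,
      weilConv_comm (moll m) (weilReflect ψ)]
  rw [e]
  refine weilFunctional_weilConv_weilReflect_eq_zero_of_re_eq_zero ha ha' h hQ
    (hψ.weilConv (isWeilTest_moll m)) ?_
  refine (tsupport_weilConv_subset hψ.2).trans ?_
  rintro x ⟨u, hu, v, hv, rfl⟩
  have hu' := hψs hu
  have hv' := WeilSquareMollifier.tsupport_moll_subset m hv
  simp only [mem_Icc] at hu' hv' ⊢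
  constructor <;> linarith [hu'.1, hu'.2, hv'.1, hv'.2]

/-- **Definiteness** (Theorem 1, "equality holds if and only if `φ = 0`", on every window `a < 2/5`):
`φ ∈ K(a)` with `Re Q(φ) = 0` vanishes — at a continuity point `x ≠ ±a`,
`φ(x) = lim_m (φ ⋆ ρ_m)(x) = 0`, and the smooth representative then vanishes on `[−a, a]` by
continuity. [cite: Yoshida1992HermitianForms, Theorem 1 p. 310] -/
theorem eq_zero_of_weilQuadratic_re_eq_zero (ha : 0 < a) (ha' : a < 2 / 5) (h : φ ∈ K a)
    (hQ : (weilQuadratic φ).re = 0) : φ = 0 := by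
  have hev := eventually_weilConv_moll_eq_zero ha ha' h hQ
  have hφi := integrable_of_mem_K h
  have hpt : ∀ x : ℝ, |x| ≠ a → φ x = 0 := by
    intro x hx
    have hT := tendsto_weilConv_moll_of_continuousAt hφi (continuousAt_of_mem_K h hx)
    have heq : (fun k ↦ weilConv φ (moll k) x) =ᶠ[atTop] fun _ ↦ (0 : ℂ) :=
      hev.mono fun m hm ↦ by simp [hm]
    exact tendsto_nhds_unique hT (tendsto_const_nhds.congr' heq.symm)
  obtain ⟨f, hf, -, hφf, hφ0⟩ := h
  have hIoo : EqOn f 0 (Ioo (-a) a) := fun x hx ↦ by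
    have hxa : |x| < a := abs_lt.2 hx
    rw [← hφf x hxa.le]
    exact hpt x hxa.ne
  have hIcc : EqOn f 0 (Icc (-a) a) := by
    refine hIoo.of_subset_closure hf.continuous.continuousOn continuousOn_const Ioo_subset_Icc_self ?_
    rw [closure_Ioo (by linarith : (-a) ≠ a)]
  funext x
  by_cases hx : |x| ≤ a
  · rw [hφf x hx]
    exact hIcc (abs_le.1 hx)
  · exact hφ0 x (not_le.1 hx)

/-- **Yoshida 1992, Theorem 1 — the named fact `Yoshida1992.theorem1` holds**: for `a = log 2/2`,
`(φ, φ) = Re Q(φ) ≥ 0` for every `φ ∈ K(a)`, with equality if and only if `φ = 0`.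
Non-negativity: `weilQuadratic_re_nonneg_of_mem_K` (mollification from the tree's `2/5` rung,
`log 2/2 < 2/5`); definiteness: `eq_zero_of_weilQuadratic_re_eq_zero` (Cauchy–Schwarz, smoothing,
Proposition 2); `Q(0) = 0` is `weilQuadratic_zero`. [cite: Yoshida1992HermitianForms, Theorem 1 p. 310] -/
theorem theorem1_holds : theorem1 := by
  intro φ hφ
  have ha : 0 < Real.log 2 / 2 := div_pos (Real.log_pos one_lt_two) two_pos
  have ha' : Real.log 2 / 2 < 2 / 5 := by linarith [Real.log_two_lt_d9]
  refine ⟨weilQuadratic_re_nonneg_of_mem_K ha ha' hφ, fun hQ ↦ ?_, fun h0 ↦ ?_⟩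
  · exact eq_zero_of_weilQuadratic_re_eq_zero ha ha' hφ (by rw [hQ, Complex.zero_re])
  · rw [h0, weilQuadratic_zero]

end Assembly

end Yoshida1992

end Literature.NumberTheory.LFunctions

end
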